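import Literature.AnabelianGeometry.EtaleTheta.ThetaSystems
import Mathlib.Data.ZMod.Basic
import Mathlib.Topology.Instances.ZMod
import Mathlib.Data.Nat.Factorial.Basic
import HarnessLib

/-!
# A degenerate inhabitant of the [EtTh] §2 tower interface `ThetaEnvTower E`; the tower form of
# Cor. 2.19 (iii) is a SCHEMA (its universal closure is false) — kernel witness

`ThetaSystems.lean` (cell `abc-iut`, seat abc-iut-L2-t2) types S. Mochizuki, *The Étale Theta Function …*
[EtTh] §2, Cor. 2.16 / 2.18 (iv) / 2.19 (ii), (iii) (PRIMS text pp. 53–65) as `Prop`-valued definitions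
over the interface `ThetaEnvTower E` (= the level data `ThetaEnvData` at every `M ∈ E` + reductions
`μ_{M'} ↠ μ_M` + `(l·Δ_Θ) ↠ μ_M`), which records the DATA named in print with its bookkeeping axioms but
none of the anabelian content.  In particular `ThetaEnvTower.Cor219_iii` (Cor. 2.19 (iii), first half,
FUNCTORIALITY content: "an arbitrary automorphism of `Π^tp_X` preserves the collection of classes up to a
`(K^×)^∧`-multiple") is meaningful — and is the discharge target of lane C2 — AT THE MODEL tower
`DoubleUnderline.thetaEnvTower` of a theta setting (`TowerOfSetting.lean`), but it is NOT a consequence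
of the interface axioms.  This file records that in the kernel, for the cell's FROZEN FACT-LIST
bookkeeping (row F-0650 is consumable AT A NAMED INSTANCE `T` only, never as `∀ T`):

* `ThetaEnvTower.Toy.toy` — for ANY admissible index set `E` (`1 ∈ E`, cofinal, totally ordered) an
  explicit tower: `Π^tp_X := ℤ³` (coordinates `(x, y, z)`, discrete abelian), `G_K := 1`,
  `Π^tp_Y := {x = 0}`, `Π^tp_Ÿ := {x = 0, y even}`, `(l·Δ_Θ) := ` the `z`-axis, `μ_M := ℤ/Mℤ` with the
  residue maps as reductions, trivial cyclotomic characters, and at each level the SINGLE theta cocycle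
  `η_M(0, y, z) = y + z (mod M)` (every interface axiom holds: cocycles, closed under the — trivial —
  coboundaries, reductions of one another, `(l·Δ_Θ) ↠ μ_M` compatible);
* `ThetaEnvTower.Toy.not_cor219_iii` — `¬ (toy …).Cor219_iii`: the automorphism `γ : y ↦ -y` of `Π^tp_X`
  stabilises `Π^tp_Ÿ`, fixes `(l·Δ_Θ)` pointwise (so the coefficient automorphisms it induces are the
  identity), and pulls `η_M` back to `(0, y, z) ↦ -y + z`, which is not `η_M · c` for any `G_K`-inflated
  cocycle `c` (all of which are trivial, `G_K = 1`) as soon as `M ∤ 4` — and `E` is cofinal;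
* `ThetaEnvTower.Toy.not_forall_cor219_iii` — the universal closure
  `∀ E (T : ThetaEnvTower E), T.Cor219_iii` is FALSE (at the factorial levels `E = {k!}`).

| FACT row | decl | witness |
|---|---|---|
| F-0650 | `ThetaEnvTower.Cor219_iii` | `not_forall_cor219_iii` (`y ↦ -y` moves the singleton collection) |

What a refutation here MEANS: only the logical shape of the interface row; nothing about [EtTh]
(a refereed paper), nor about the model tower of lane C2, where the row is REFINED by the standard-type
statement `MuTwoSetting.Cor219_iii_std` (`ThetaSystemsStandard.lean`, `cor219_iii_of_std`) and feeds
`DoubleUnderline.cor219_ii_model_of_facts`.  Rows F-0649 `Cor219_ii`, F-0648 `Cor218_iv_reduction` are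
not treated here (the toy does not decide them cheaply).  Written by the cell `abc-iut` (seat
abc-iut-f-154, F-TRANCHES 154 of D-0078 (S1)).  No bearing on [IUTchIII] Cor. 3.12; no side taken;
typed ≠ proved.  No instances, no notation.

## References

* [MochizukiEtTh2009] S. Mochizuki, *The étale theta function and its Frobenioid-theoretic
  manifestations*, Publ. RIMS 45 (2009): Def. 2.10 p.44, Def. 2.13 pp.47–48, Cor. 2.19 (ii), (iii)
  pp.64–65 (PRIMS text pages).
-/

namespace Literature.AnabelianGeometry.EtaleTheta

namespace ThetaEnvTower

namespace Toy

/-! ## §0. An admissible index set: the factorial levels `E = {k! : k ≥ 1}` -/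

/-- The factorial levels `{k! : k ≥ 1} ⊆ ℕ≥1`. [cite: MochizukiEtTh2009, Cor 2.19(ii) p.64] -/
def facLevels : Set ℕ+ := Set.range fun k : ℕ+ => (⟨(k : ℕ).factorial, Nat.factorial_pos k⟩ : ℕ+)

/-- `1 = 1!` is a level. [cite: MochizukiEtTh2009, Cor 2.19(ii) p.64] -/
theorem one_mem_facLevels : (1 : ℕ+) ∈ facLevels := ⟨1, PNat.eq (by simp)⟩

/-- The factorial levels are cofinal in `(ℕ≥1, ∣)`: `n ∣ n!`. [cite: MochizukiEtTh2009, Cor 2.19(ii) p.64] -/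
theorem facLevels_cofinal (n : ℕ+) : ∃ M ∈ facLevels, n ∣ M :=
  ⟨⟨(n : ℕ).factorial, Nat.factorial_pos n⟩, ⟨n, rfl⟩, PNat.dvd_iff.2 (Nat.dvd_factorial n.pos le_rfl)⟩

/-- The factorial levels are totally ordered by divisibility. [cite: MochizukiEtTh2009, Cor 2.19(ii) p.64] -/
theorem facLevels_total (M : ℕ+) (hM : M ∈ facLevels) (M' : ℕ+) (hM' : M' ∈ facLevels) :
    M ∣ M' ∨ M' ∣ M := by
  obtain ⟨k, rfl⟩ := hM
  obtain ⟨k', rfl⟩ := hM'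
  rcases le_total (k : ℕ) k' with h | h
  · exact Or.inl (PNat.dvd_iff.2 (Nat.factorial_dvd_factorial h))
  · exact Or.inr (PNat.dvd_iff.2 (Nat.factorial_dvd_factorial h))

/-! ## §1. The group data: `Π^tp_X = ℤ³`, `Π^tp_Y`, `Π^tp_Ÿ`, `(l·Δ_Θ)` -/

/-- `ℤ` written multiplicatively. [cite: MochizukiEtTh2009, Def 2.13 p.47] -/
abbrev Zm : Type := Multiplicative ℤ

/-- The toy `Π^tp_X := ℤ³`, coordinates `(x, (y, z))` (discrete, abelian). [cite: MochizukiEtTh2009, Def 2.13 p.47] -/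
abbrev P : Type := Zm × (Zm × Zm)

/-- The `x`-coordinate `Π → ℤ`. [cite: MochizukiEtTh2009, Def 2.13 p.47] -/
abbrev px : P →* Zm := MonoidHom.fst Zm (Zm × Zm)

/-- The `y`-coordinate `Π → ℤ`. [cite: MochizukiEtTh2009, Def 2.13 p.47] -/
abbrev py : P →* Zm := (MonoidHom.fst Zm Zm).comp (MonoidHom.snd Zm (Zm × Zm))

/-- The `z`-coordinate `Π → ℤ`. [cite: MochizukiEtTh2009, Def 2.13 p.47] -/
abbrev pz : P →* Zm := (MonoidHom.snd Zm Zm).comp (MonoidHom.snd Zm (Zm × Zm))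

/-- `ℤ/2` written multiplicatively. [cite: MochizukiEtTh2009, Def 2.13 p.47] -/
abbrev M2 : Type := Multiplicative (ZMod 2)

/-- The `y`-coordinate mod `2`, `Π → ℤ/2`. [cite: MochizukiEtTh2009, Def 2.13 p.47] -/
def py2 : P →* M2 := (AddMonoidHom.toMultiplicative (Int.castAddHom (ZMod 2))).comp py

/-- `py2` on a tuple. [cite: MochizukiEtTh2009, Def 2.13 p.47] -/
@[simp] theorem py2_apply (x y z : Zm) :
    py2 (x, (y, z)) = Multiplicative.ofAdd (((Multiplicative.toAdd y : ℤ)) : ZMod 2) := rfl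

/-- `Π^tp_Y := {x = 0} = Ker(Π ↠ ℤ)`. [cite: MochizukiEtTh2009, Def 2.13 p.47] -/
abbrev PiY0 : Subgroup P := px.ker

/-- `Π^tp_Ÿ := {x = 0, y even}`. [cite: MochizukiEtTh2009, Def 2.13 p.47] -/
abbrev PiYdd0 : Subgroup P := py2.ker ⊓ PiY0

/-- `(l·Δ_Θ) :=` the `z`-axis `{x = 0, y = 0}`. [cite: MochizukiEtTh2009, Prop 2.12 p.45] -/
abbrev L0 : Subgroup P := py.ker ⊓ PiY0

/-- Membership in `Π^tp_Y`. [cite: MochizukiEtTh2009, Def 2.13 p.47] -/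
theorem mem_PiY0_iff (g : P) : g ∈ PiY0 ↔ g.1 = 1 := by
  rw [MonoidHom.mem_ker]; rfl

/-- Membership in `Π^tp_Ÿ`. [cite: MochizukiEtTh2009, Def 2.13 p.47] -/
theorem mem_PiYdd0_iff (x y z : Zm) : ((x, (y, z)) : P) ∈ PiYdd0 ↔
    (((Multiplicative.toAdd y : ℤ)) : ZMod 2) = 0 ∧ x = 1 := by
  rw [Subgroup.mem_inf, MonoidHom.mem_ker, MonoidHom.mem_ker, py2_apply]
  constructor
  · rintro ⟨h1, h2⟩
    exact ⟨by simpa using congrArg Multiplicative.toAdd h1, h2⟩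
  · rintro ⟨h1, h2⟩
    exact ⟨by rw [h1]; rfl, h2⟩

/-- Membership in `(l·Δ_Θ)`. [cite: MochizukiEtTh2009, Prop 2.12 p.45] -/
theorem mem_L0_iff (x y z : Zm) : ((x, (y, z)) : P) ∈ L0 ↔ y = 1 ∧ x = 1 := by
  rw [Subgroup.mem_inf, MonoidHom.mem_ker, MonoidHom.mem_ker]; rfl

/-- `[Π^tp_Y : Π^tp_Ÿ] = 2` at the toy. [cite: MochizukiEtTh2009, Def 2.13 p.47] -/
theorem index_PiYdd0 : (PiYdd0.subgroupOf PiY0).index = 2 := by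
  change PiYdd0.relIndex PiY0 = 2
  rw [Subgroup.inf_relIndex_right, Subgroup.relIndex_ker]
  have hmap : PiY0.map py2 = ⊤ := by
    refine top_le_iff.mp fun a _ => ?_
    obtain ⟨n, hn⟩ := ZMod.intCast_surjective (Multiplicative.toAdd a)
    refine ⟨(1, (Multiplicative.ofAdd n, 1)), (mem_PiY0_iff _).2 rfl, ?_⟩
    rw [py2_apply, toAdd_ofAdd, hn, ofAdd_toAdd]
  rw [hmap, Subgroup.card_top, Nat.card_eq_fintype_card]
  rfl

/-! ## §2. The cyclotomes `μ_M = ℤ/M`, reductions, the toy cocycles -/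

/-- `μ_n := ℤ/nℤ`, written multiplicatively. [cite: MochizukiEtTh2009, Def 2.10 p.44] -/
abbrev Mu (n : ℕ+) : Type := Multiplicative (ZMod n)

/-- `ℤ → ℤ/n`, multiplicatively. [cite: MochizukiEtTh2009, Def 2.10 p.44] -/
def castM (n : ℕ+) : Zm →* Mu n := AddMonoidHom.toMultiplicative (Int.castAddHom (ZMod n))

/-- `castM` in coordinates. [cite: MochizukiEtTh2009, Def 2.10 p.44] -/
@[simp] theorem castM_apply (n : ℕ+) (z : Zm) :
    castM n z = Multiplicative.ofAdd (((Multiplicative.toAdd z : ℤ)) : ZMod n) := rfl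

/-- The reduction `μ_{n'} ↠ μ_n` (`n ∣ n'`): the residue map. [cite: MochizukiEtTh2009, Def 2.13(ii) p.48] -/
def redMu (n n' : ℕ+) (h : (n : ℕ) ∣ n') : Mu n' →* Mu n :=
  AddMonoidHom.toMultiplicative (ZMod.castHom h (ZMod n)).toAddMonoidHom

/-- `redMu` in coordinates. [cite: MochizukiEtTh2009, Def 2.13(ii) p.48] -/
@[simp] theorem redMu_apply (n n' : ℕ+) (h : (n : ℕ) ∣ n') (a : Mu n') :
    redMu n n' h a = Multiplicative.ofAdd (ZMod.castHom h (ZMod n) (Multiplicative.toAdd a)) := rfl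

/-- `redMu ∘ castM = castM`. [cite: MochizukiEtTh2009, Def 2.13(ii) p.48] -/
theorem redMu_castM (n n' : ℕ+) (h : (n : ℕ) ∣ n') (z : Zm) : redMu n n' h (castM n' z) = castM n z := by
  simp [map_intCast]

/-- The reductions are onto. [cite: MochizukiEtTh2009, Def 2.13(ii) p.48] -/
theorem redMu_surjective (n n' : ℕ+) (h : (n : ℕ) ∣ n') : Function.Surjective (redMu n n' h) := by
  intro a
  obtain ⟨m, hm⟩ := ZMod.intCast_surjective (Multiplicative.toAdd a)
  refine ⟨castM n' (Multiplicative.ofAdd m), ?_⟩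
  rw [redMu_castM, castM_apply, toAdd_ofAdd, hm, ofAdd_toAdd]

/-- `μ_n ↠ μ_n` is the identity. [cite: MochizukiEtTh2009, Def 2.13(ii) p.48] -/
theorem redMu_self (n : ℕ+) (h : (n : ℕ) ∣ n) (a : Mu n) : redMu n n h a = a := by
  rw [redMu_apply, ZMod.castHom_self, RingHom.id_apply, ofAdd_toAdd]

/-- Transitivity of the reductions. [cite: MochizukiEtTh2009, Def 2.13(ii) p.48] -/
theorem redMu_comp (n n' n'' : ℕ+) (h : (n : ℕ) ∣ n') (h' : (n' : ℕ) ∣ n'') (a : Mu n'') :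
    redMu n n'' (h.trans h') a = redMu n n' h (redMu n' n'' h' a) := by
  rw [redMu_apply, redMu_apply, redMu_apply, toAdd_ofAdd, ← RingHom.comp_apply, ZMod.castHom_comp]

/-- The toy cocycle as a homomorphism on all of `Π^tp_X`: `(x, y, z) ↦ y + z (mod n)`.
[cite: MochizukiEtTh2009, Def 2.13 p.47] -/
def etaHom (n : ℕ+) : P →* Mu n := (castM n).comp (py * pz)

/-- `etaHom` in coordinates. [cite: MochizukiEtTh2009, Def 2.13 p.47] -/
@[simp] theorem etaHom_apply (n : ℕ+) (x y z : Zm) : etaHom n (x, (y, z)) =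
    Multiplicative.ofAdd (((Multiplicative.toAdd y + Multiplicative.toAdd z : ℤ)) : ZMod n) := rfl

/-- THE toy theta cocycle at level `n`: `Π^tp_Ÿ → μ_n`, `(0, y, z) ↦ y + z (mod n)`.
[cite: MochizukiEtTh2009, Def 2.13 p.47] -/
def eta (n : ℕ+) : PiYdd0 → Mu n := fun g => etaHom n (g : P)

/-- `redMu ∘ η_{n'} = η_n`. [cite: MochizukiEtTh2009, Def 2.13(ii) p.48] -/
theorem redMu_eta (n n' : ℕ+) (h : (n : ℕ) ∣ n') (g : PiYdd0) : redMu n n' h (eta n' g) = eta n g :=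
  redMu_castM n n' h _

/-! ## §3. The toy tower -/

variable {E : Set ℕ+}

/-- **The toy `ThetaEnvTower E`** over any admissible index set `E` (`1 ∈ E`, cofinal, totally ordered):
`Π^tp_X = ℤ³` discrete abelian, `G_K = 1`, `Π^tp_Y = {x = 0}`, `Π^tp_Ÿ = {x = 0, y even}`, `(l·Δ_Θ)` = the
`z`-axis, `μ_M = ℤ/M` with the residue maps, trivial cyclotomic characters, theta cocycles `{η_M}` with
`η_M(0, y, z) = y + z`.  Every axiom of the interface is satisfied. [cite: MochizukiEtTh2009, Cor 2.19(ii) p.64] -/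
@[reducible] noncomputable def toy (h1 : (1 : ℕ+) ∈ E) (hcof : ∀ n : ℕ+, ∃ M ∈ E, n ∣ M)
    (htot : ∀ M ∈ E, ∀ M' ∈ E, M ∣ M' ∨ M' ∣ M) : ThetaEnvTower.{0} E where
  one_mem := h1
  cofinal := hcof
  total := htot
  PiX := P
  G := PUnit
  aug := 1
  aug_surjective := fun _ => ⟨1, Subsingleton.elim _ _⟩
  PiY := PiY0
  PiY_normal := inferInstance
  PiY_open := isOpen_discrete _
  galYX := QuotientGroup.quotientKerEquivOfSurjective px (fun z => ⟨(z, 1), rfl⟩)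
  PiYdd := PiYdd0
  PiYdd_le := inf_le_right
  PiYdd_normal := inferInstance
  PiYdd_open := isOpen_discrete _
  index_PiYdd := index_PiYdd0
  mu := fun M => Mu M
  mu_cyclic := fun _ => inferInstance
  card_mu := fun M => by rw [Fintype.card_multiplicative, ZMod.card]
  chi := fun _ => 1
  chi_ker_open := fun _ => isOpen_discrete _
  thetaCocycles := fun M => {eta M}
  thetaCocycles_nonempty := fun _ => Set.singleton_nonempty _
  isCocycle := fun M η hη g h => by
    rw [Set.mem_singleton_iff] at hη
    subst hη
    rw [MonoidHom.one_apply, MulAut.one_apply]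
    exact map_mul (etaHom M) _ _
  locallyConstant := fun M η _ => IsLocallyConstant.of_discrete η
  mul_coboundary_mem := fun M η hη c => by
    rw [Set.mem_singleton_iff] at hη ⊢
    subst hη
    funext g
    simp [CycEnvelope.coboundary]
  red := fun M M' h => redMu M M' (PNat.dvd_iff.1 h)
  red_surjective := fun M M' h => redMu_surjective _ _ _
  red_self := fun M h a => redMu_self _ _ a
  red_comp := fun M M' M'' h h' a => redMu_comp _ _ _ (PNat.dvd_iff.1 h) (PNat.dvd_iff.1 h') a
  red_chi := fun M M' h g a => by simp only [MonoidHom.one_apply, MulAut.one_apply]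
  red_cocycle_mem := fun M M' h η hη => by
    rw [Set.mem_singleton_iff] at hη ⊢
    subst hη
    funext g
    exact redMu_eta _ _ _ g
  red_cocycle_surj := fun M M' h η hη => by
    rw [Set.mem_singleton_iff] at hη
    subst hη
    exact ⟨eta M', rfl, funext fun g => redMu_eta _ _ _ g⟩
  lDeltaTheta := L0
  thetaMod := fun M => (castM M).comp (pz.comp L0.subtype)
  thetaMod_surjective := fun M a => by
    obtain ⟨m, hm⟩ := ZMod.intCast_surjective (Multiplicative.toAdd a)
    refine ⟨⟨(1, (1, Multiplicative.ofAdd m)), (mem_L0_iff _ _ _).2 ⟨rfl, rfl⟩⟩, ?_⟩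
    rw [MonoidHom.comp_apply, MonoidHom.comp_apply, castM_apply]
    change Multiplicative.ofAdd (((Multiplicative.toAdd (Multiplicative.ofAdd m) : ℤ)) : ZMod M) = a
    rw [toAdd_ofAdd, hm, ofAdd_toAdd]
  red_thetaMod := fun M M' h g => redMu_castM _ _ _ _

/-- The tower interface is inhabited over the factorial levels: the schema row below is refuted by a MODEL
of the interface, not by an inconsistency. [cite: MochizukiEtTh2009, Cor 2.19(ii) p.64] -/
theorem nonempty_thetaEnvTower : Nonempty (ThetaEnvTower.{0} facLevels) :=
  ⟨toy one_mem_facLevels facLevels_cofinal facLevels_total⟩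

/-! ## §4. The automorphism `y ↦ -y` and the refutation of the closure of `Cor219_iii` -/

/-- The automorphism `(x, y, z) ↦ (x, -y, z)` of the (discrete) topological group `Π^tp_X = ℤ³`.
[cite: MochizukiEtTh2009, Cor 2.19(iii) p.65] -/
def negY : P ≃ₜ* P :=
  { MulEquiv.prodCongr (MulEquiv.refl Zm) (MulEquiv.prodCongr (MulEquiv.inv Zm) (MulEquiv.refl Zm)) with
    continuous_toFun := continuous_of_discreteTopology
    continuous_invFun := continuous_of_discreteTopology }

/-- `negY` on a tuple. [cite: MochizukiEtTh2009, Cor 2.19(iii) p.65] -/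
@[simp] theorem negY_apply (x y z : Zm) : negY (x, (y, z)) = (x, (y⁻¹, z)) := rfl

/-- `negY` is an involution. [cite: MochizukiEtTh2009, Cor 2.19(iii) p.65] -/
theorem negY_negY (g : P) : negY (negY g) = g := by
  obtain ⟨x, y, z⟩ := g
  rw [negY_apply, negY_apply, inv_inv]

/-- `negY` stabilises `Π^tp_Ÿ` (elementwise). [cite: MochizukiEtTh2009, Cor 2.19(iii) p.65] -/
theorem negY_mem_PiYdd0_iff (g : P) : negY g ∈ PiYdd0 ↔ g ∈ PiYdd0 := by
  obtain ⟨x, y, z⟩ := g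
  rw [negY_apply, mem_PiYdd0_iff, mem_PiYdd0_iff, toAdd_inv, Int.cast_neg, neg_eq_zero]

/-- `negY` stabilises `Π^tp_Ÿ`. [cite: MochizukiEtTh2009, Cor 2.19(iii) p.65] -/
theorem map_negY_PiYdd0 : PiYdd0.map negY.toMulEquiv.toMonoidHom = PiYdd0 := by
  ext g
  constructor
  · rintro ⟨g', hg', rfl⟩
    exact (negY_mem_PiYdd0_iff g').2 hg'
  · intro hg
    exact ⟨negY g, (negY_mem_PiYdd0_iff g).2 hg, negY_negY g⟩

/-- The element `(0, 2, 0) ∈ Π^tp_Ÿ` at which the pulled-back cocycle differs.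
[cite: MochizukiEtTh2009, Cor 2.19(iii) p.65] -/
theorem two_mem_PiYdd0 : ((1, (Multiplicative.ofAdd (2 : ℤ), 1)) : P) ∈ PiYdd0 :=
  (mem_PiYdd0_iff _ _ _).2 ⟨by rw [toAdd_ofAdd]; decide, rfl⟩

/-- **`Cor219_iii` FAILS at the toy tower** (any admissible `E`): for `γ = negY` (which fixes `(l·Δ_Θ)`
pointwise, so that the induced coefficient automorphisms are the identity) the pulled-back collection
`{η_M ∘ γ}` is not `{η_M · c_M}` for any family `c` of `G_K`-inflated cocycles — these are all trivial
(`G_K = 1`), while `η_M(0, -2, 0) = -2 ≠ 2 = η_M(0, 2, 0)` at a level `M ∈ E` with `3 ∣ M`.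
[cite: MochizukiEtTh2009, Cor 2.19(iii) p.65] -/
theorem not_cor219_iii (h1 : (1 : ℕ+) ∈ E) (hcof : ∀ n : ℕ+, ∃ M ∈ E, n ∣ M)
    (htot : ∀ M ∈ E, ∀ M' ∈ E, M ∣ M' ∨ M' ∣ M) : ¬ (toy h1 hcof htot).Cor219_iii := by
  intro h
  obtain ⟨c, hc, -, -, himg⟩ :=
    h negY map_negY_PiYdd0 (fun _ => MulEquiv.refl _) (fun _ _ _ => rfl)
  obtain ⟨M, hME, h3⟩ := hcof 3
  -- the `G_K`-inflated cocycles are trivial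
  have hc1 : ∀ u : PUnit, c ⟨M, hME⟩ u = 1 := by
    intro u
    obtain rfl : u = 1 := Subsingleton.elim _ _
    have h11 := hc ⟨M, hME⟩ 1 1
    rw [mul_one, MonoidHom.one_apply, MulAut.one_apply] at h11
    exact left_eq_mul.mp h11
  -- compare the two singleton collections at `(0, 2, 0)`
  have key := himg ⟨M, hME⟩
  rw [Set.image_singleton, Set.image_singleton, Set.singleton_eq_singleton_iff] at key
  have key2 := congrFun key ⟨(1, (Multiplicative.ofAdd (2 : ℤ), 1)), two_mem_PiYdd0⟩
  rw [Pi.mul_apply, Function.comp_apply, Function.comp_apply, hc1, mul_one] at key2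
  change eta M ⟨negY (1, (Multiplicative.ofAdd (2 : ℤ), 1)), _⟩ = eta M _ at key2
  simp only [eta, negY_apply, etaHom_apply, toAdd_inv, toAdd_ofAdd, toAdd_one, add_zero] at key2
  have key3 : (((-2 : ℤ)) : ZMod M) = ((2 : ℤ) : ZMod M) := Multiplicative.ofAdd.injective key2
  rw [ZMod.intCast_eq_intCast_iff_dvd_sub] at key3
  norm_num at key3
  have h4 : ((M : ℕ+) : ℕ) ∣ 4 := by exact_mod_cast key3
  exact absurd ((PNat.dvd_iff.1 h3).trans h4) (by decide)

/-- **The universal closure of the schema `ThetaEnvTower.Cor219_iii` is FALSE**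
(FACT-LIST row F-0650: instance-only). [cite: MochizukiEtTh2009, Cor 2.19(iii) p.65] -/
theorem not_forall_cor219_iii : ¬ ∀ (E : Set ℕ+) (T : ThetaEnvTower.{0} E), T.Cor219_iii :=
  fun h => not_cor219_iii one_mem_facLevels facLevels_cofinal facLevels_total (h _ _)

end Toy

end ThetaEnvTower

end Literature.AnabelianGeometry.EtaleTheta
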